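import Literature.AnabelianGeometry.AbsoluteAnabelian.DiagramUniversalFamilies
import Literature.AnabelianGeometry.AbsoluteAnabelian.DiagramShiftInvariance

/-!
# Invariance of lifts and of the universal family of homotopies under a graph morphism fixing the diagram
# ([AbsTopIII] Def. 3.5 (ii)/(iv), Rmk. 3.5.1)

S. Mochizuki, *Topics in Absolute Anabelian Geometry III*, Def. 3.5 (ii), (iv) pp. 75–76 and Rmk. 3.5.1 p. 78
of the kurims manuscript (`paper:url-5493eb38cbb7`; bib key `MochizukiAbsTopIII2015`).  Sequel of
`DiagramShiftInvariance.lean` (seat abc-iut-w6-d023; toolkit for Cor. 3.6 (v), third sentence): the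
structure functors `(N, μ)` over `𝒞` of `DiagramCores.OverData` pulled back along a graph morphism `F`
(`OverData.comapAlong`), the identification of the lifts of `F^*(N, μ)` (`DiagramLifts.lean`: the homotopy of
a co-verticial pair into a vertex with fully faithful structure functor) with the lifts of `(N, μ)` along `F`
(`OverData.lift_comapAlong`), their invariance when `F^*𝒟 = 𝒟` and `F^*(N, μ) ≍ (N, μ)`
(`OverData.lift_mapPath_heq`), and consequently the INVARIANCE OF THE UNIVERSAL FAMILY of
`DiagramUniversalFamilies.lean` under such `F` preserving the set `W` of fully faithful vertices
(`univFamily_η_mapPath_heq`) — used for the cores family `K₀` of [AbsTopIII] Cor. 3.6 (i) under the nexus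
self-equivalences of Cor. 3.6 (v).  Pure category-theoretic plumbing; no claim of the paper is asserted;
nothing here bears on [IUTchIII] Cor. 3.12.
-/

namespace Literature.AnabelianGeometry.AbsoluteAnabelian

open _root_.CategoryTheory _root_.Quiver

universe v u w

namespace DiagramOfCategories

variable {V : Type w} [Quiver.{v} V] {D : DiagramOfCategories.{v, u, w} V}
  {V' : Type w} [Quiver.{v} V']

/-! ### Structure functors pulled back along a graph morphism; invariance of lifts -/

namespace OverData

variable {C : Type u} [Category.{v} C]

/-- **`F^*(N, μ)`**: structure functors over `𝒞` (`DiagramCores.OverData`: functors `N_v : 𝒟_v ⥤ 𝒞` with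
`𝒟_e ⋙ N_{v₂} ≅ N_{v₁}`, Rmk. 3.5.1 "the constant portion under the diagram") pulled back along a graph
morphism `F` to the diagram `F^*𝒟`. [cite: MochizukiAbsTopIII2015, Remark 3.5.1 p.78] -/
abbrev comapAlong (O : D.OverData C) (F : V' ⥤q V) : (D.comapAlong F).OverData C where
  N a := O.N (F.obj a)
  μ e := O.μ (F.map e)

/-- `eqToHom` bookkeeping: an inverse pair of `eqToHom`s in the middle of a composite cancels (applied by
`exact`, which unifies the objects up to definitional unfolding). [folklore] -/
private theorem eqToHom_conj_cancel {C : Type*} [Category C] {a₀ a b b' c : C} (M : a ⟶ b) (P : b ⟶ c)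
    (h₁ : a₀ = a) (h₂ : b = b') (h₃ : b' = b) (h₄ : a₀ = a) :
    eqToHom h₁ ≫ M ≫ eqToHom h₂ ≫ eqToHom h₃ ≫ P = eqToHom h₄ ≫ M ≫ P := by
  subst h₂; simp

/-- The path isomorphisms `𝒟_{[γ]} ⋙ N ≅ N` of `F^*(N, μ)` are those of `(N, μ)` along `F` (re-typed along
`(F^*𝒟)_{[γ]} = 𝒟_{F[γ]}`). [cite: MochizukiAbsTopIII2015, Definition 3.5 (i) p.75] -/
theorem pathIso_comapAlong (O : D.OverData C) (F : V' ⥤q V) {a : V'} :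
    ∀ {b : V'} (p : Path a b), (O.comapAlong F).pathIso p =
      eqToIso (congrArg (· ⋙ O.N (F.obj b)) (D.pathFunctor_comapAlong F p)) ≪≫ O.pathIso (F.mapPath p) := by
  intro b p
  induction p with
  | nil =>
    ext x
    simp only [Prefunctor.mapPath_nil, Iso.trans_hom, eqToIso.hom, NatTrans.comp_app, eqToHom_app,
      pathIso_nil_app, eqToHom_trans]
  | cons p e ih =>
    rename_i b c
    ext x
    have hx : ((D.comapAlong F).pathFunctor p).obj x = (D.pathFunctor (F.mapPath p)).obj x :=
      Functor.congr_obj (D.pathFunctor_comapAlong F p) x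
    simp only [Prefunctor.mapPath_cons, Iso.trans_hom, eqToIso.hom, NatTrans.comp_app, eqToHom_app,
      pathIso_cons_app]
    rw [ih]
    simp only [Iso.trans_hom, eqToIso.hom, NatTrans.comp_app, eqToHom_app]
    rw [NatTrans.congr (O.μ (F.map e)).hom hx]
    simp only [eqToHom_map, Category.assoc, eqToHom_trans_assoc]
    exact eqToHom_conj_cancel _ _ _ _ _ _

/-- **The lifts of `F^*(N, μ)` are the lifts of `(N, μ)` along `F`** (heterogeneously, along
`(F^*𝒟)_{[γ]} = 𝒟_{F[γ]}`): the homotopy of a co-verticial pair `([γ₁],[γ₂])` of `F^*𝒟` into a vertex with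
fully faithful structure functor is the homotopy of `(F[γ₁], F[γ₂])`.
[cite: MochizukiAbsTopIII2015, Definition 3.5 (ii) p.75] -/
theorem lift_comapAlong (O : D.OverData C) (F : V' ⥤q V) {a w : V'} (hw : (O.N (F.obj w)).FullyFaithful)
    (p q : Path a w) :
    HEq ((O.comapAlong F).lift hw p q) (O.lift hw (F.mapPath p) (F.mapPath q)) := by
  unfold OverData.lift
  have aux : ∀ {X X' Y : (D.comapAlong F).obj a ⥤ C} (h : X = X') (e : X' ≅ Y), HEq (eqToIso h ≪≫ e) e := by
    intro X X' Y h e; subst h; simp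
  exact liftThrough_congr hw (D.pathFunctor_comapAlong F p) (D.pathFunctor_comapAlong F q)
    ((heq_of_eq (O.pathIso_comapAlong F p)).trans (aux _ _))
    ((heq_of_eq (O.pathIso_comapAlong F q)).trans (aux _ _))

/-- Structure functors on EQUAL diagrams that agree vertex by vertex and edge by edge are (heterogeneously)
equal. [cite: MochizukiAbsTopIII2015, Remark 3.5.1 p.78] -/
theorem heq_of_eq {D₁ D₂ : DiagramOfCategories.{v, u, w} V} (hD : D₁ = D₂) {O₁ : D₁.OverData C}
    {O₂ : D₂.OverData C} (hN : ∀ a : V, HEq (O₁.N a) (O₂.N a))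
    (hμ : ∀ ⦃a b : V⦄ (e : a ⟶ b), HEq (O₁.μ e) (O₂.μ e)) : HEq O₁ O₂ := by
  subst hD
  obtain ⟨N₁, μ₁⟩ := O₁
  obtain ⟨N₂, μ₂⟩ := O₂
  obtain rfl : N₁ = N₂ := funext fun a => eq_of_heq (hN a)
  have hμ' : @μ₁ = @μ₂ := by
    funext a b e
    exact eq_of_heq (hμ e)
  subst hμ'
  rfl

/-- Lifts are invariant under (heterogeneous) equality of all the data. [cite: MochizukiAbsTopIII2015, Remark 3.5.1 p.78] -/
theorem lift_heq_of_eq {D₁ D₂ : DiagramOfCategories.{v, u, w} V} (hD : D₁ = D₂) {O₁ : D₁.OverData C}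
    {O₂ : D₂.OverData C} (hO : HEq O₁ O₂) {a w : V} {hw₁ : (O₁.N w).FullyFaithful}
    {hw₂ : (O₂.N w).FullyFaithful} (hw : HEq hw₁ hw₂) (p q : Path a w) :
    HEq (O₁.lift hw₁ p q) (O₂.lift hw₂ p q) := by
  subst hD; cases hO; cases hw; rfl

/-- **Invariance of lifts under a graph morphism fixing the diagram and the structure functors**: if
`F^*𝒟 = 𝒟` and `F^*(N, μ) ≍ (N, μ)`, the homotopy of `(F[γ₁], F[γ₂])` is (heterogeneously) that of
`([γ₁],[γ₂])` — the "constant portion under the diagram" (Rmk. 3.5.1) does not see the re-indexing.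
[cite: MochizukiAbsTopIII2015, Remark 3.5.1 p.78] -/
theorem lift_mapPath_heq (O : D.OverData C) (F : V ⥤q V) (hD : D.comapAlong F = D)
    (hO : HEq (O.comapAlong F) O) {a w : V} (hw : (O.N (F.obj w)).FullyFaithful)
    (hw' : (O.N w).FullyFaithful) (hww : HEq hw hw') (p q : Path a w) :
    HEq (O.lift hw (F.mapPath p) (F.mapPath q)) (O.lift hw' p q) :=
  (O.lift_comapAlong F hw p q).symm.trans (lift_heq_of_eq hD hO (hw₁ := hw) hww p q)

end OverData

/-! ### Invariance of the universal family of homotopies -/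

section Universal

variable {C : Type u} [Category.{v} C] (O : D.OverData C) (W : V → Prop)
  (hW : ∀ w, W w → (O.N w).FullyFaithful)

/-- A decomposition through `W` is mapped to a decomposition through `W` by a graph morphism preserving
`W` (Def. 3.5 (iv) (b): the pairs `([σ]∘[γ₁], [σ]∘[γ₂])`). [cite: MochizukiAbsTopIII2015, Definition 3.5 (iv) p.76] -/
def Decomp.mapPath (F : V ⥤q V) (hWF : ∀ w, W w → W (F.obj w)) {a b : V} {P Q : Path a b}
    (d : Decomp W P Q) : Decomp W (F.mapPath P) (F.mapPath Q) where
  w := F.obj d.w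
  mem := hWF _ d.mem
  p := F.mapPath d.p
  q := F.mapPath d.q
  s := F.mapPath d.s
  left_eq := by rw [← Prefunctor.mapPath_comp, ← d.left_eq]
  right_eq := by rw [← Prefunctor.mapPath_comp, ← d.right_eq]

/-- The boundary set `E_W` is stable under a graph morphism preserving `W`.
[cite: MochizukiAbsTopIII2015, Definition 3.5 (iv) p.76] -/
theorem univE_mapPath (F : V ⥤q V) (hWF : ∀ w, W w → W (F.obj w)) {a b : V} {P Q : Path a b}
    (h : univE W P Q) : univE W (F.mapPath P) (F.mapPath Q) :=
  let ⟨d⟩ := h; ⟨d.mapPath W F hWF⟩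

/-- **Invariance of the universal family** (`univFamily`, Def. 3.5 (ii)/(iv): homotopy of
`([σ]∘[γ₁], [σ]∘[γ₂])` = `lift γ₁ γ₂ ▷ 𝒟_[σ]`) under a graph morphism `F` with `F^*𝒟 = 𝒟`, `F^*(N, μ) ≍ (N, μ)`,
`F(W) ⊆ W` and the SAME full-faithfulness witnesses at `w` and `F w`: the homotopy of `(F[γ₁], F[γ₂])` is
(heterogeneously) that of `([γ₁],[γ₂])`. [cite: MochizukiAbsTopIII2015, Definition 3.5 (ii) p.75] -/
theorem univFamily_η_mapPath_heq (F : V ⥤q V) (hD : D.comapAlong F = D) (hO : HEq (O.comapAlong F) O)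
    (hWF : ∀ w, W w → W (F.obj w)) (hhW : ∀ (w : V) (m : W w), HEq (hW (F.obj w) (hWF w m)) (hW w m))
    {a b : V} {P Q : Path a b} (h : univE W P Q) (h' : univE W (F.mapPath P) (F.mapPath Q)) :
    HEq ((univFamily O W hW).η h') ((univFamily O W hW).η h) := by
  let d : Decomp W P Q := Classical.choice h
  rw [univFamily_η_eq O W hW h' (d.mapPath W F hWF), univFamily_η_eq O W hW h d]
  unfold Decomp.η
  refine eqToHom_comp_comp_eqToHom_heq_of_heq _ _ _
    (HEq.symm (eqToHom_comp_comp_eqToHom_heq_of_heq _ _ _ (HEq.symm ?_)))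
  exact Functor.whiskerRight_heq'' (D.obj_eq_of_comapAlong_eq F hD a) (D.cat_heq_of_comapAlong_eq F hD a)
    (D.obj_eq_of_comapAlong_eq F hD d.w) (D.cat_heq_of_comapAlong_eq F hD d.w)
    (D.obj_eq_of_comapAlong_eq F hD b) (D.cat_heq_of_comapAlong_eq F hD b)
    (D.pathFunctor_mapPath_heq F hD d.p) (D.pathFunctor_mapPath_heq F hD d.q)
    (O.lift_mapPath_heq F hD hO _ _ (hhW _ d.mem) d.p d.q) (D.pathFunctor_mapPath_heq F hD d.s)

end Universal


end DiagramOfCategories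

end Literature.AnabelianGeometry.AbsoluteAnabelian
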